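/-
Copyright: the b2b-balaban T⁴-continuum CRUX team, row NE7b OWNER lineage `t4-ne7b-p1` (gen 141). Project licence.
-/
import Summits.QuantumFields.BalabanUV.T4Continuum.Spine.NE7b.SupWhitenedThirdKernelLetter

/-!
# THE GEOMETRY LETTERS OF A FINITE-RANGE FACTOR (SCOPING (d12)(2)): the WEIGHTED hypotheses of the third-order kernel letter (475) —
# the submultiplicative sampler weight `θ ≥ 1`, the cross weight `σ`, the site weight `ρ` with `ρ⁸ ≤ σσ`, the weighted smallness
# `Σ_w C_{xw}θ_{xw} ≤ γθ`, `Σ_x C_{xw}θ_{xw} ≤ γθ′` of the whitened Dobrushin matrix and the weighted profiles `αθ, βθ` of the observables —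
# are DISCHARGED for the exponential weights of ONE pseudometric (`θ_{zw} = e^{8μ·d(q z,q w)}`, `σ_{xw} = e^{8μ·d(p x,q w)}`,
# `ρ_{xy} = e^{μ·d(p x,p y)}`, sites placed by `p : ι → X`, sampler indices by `q : κ → X`) and a FINITE-RANGE factor `A` (`A_{uw} ≠ 0 ⟹
# d(p u, q w) ≤ R`) with a finite-range Hessian majorant (`Hk_{vu} ≠ 0 ⟹ d(p v, p u) ≤ R′`): by two triangle inequalities every non-zero
# term of `C_{xw}` has `d(q x, q w) ≤ 2R + R′` and every non-zero term of the profile `a^v_w` has `d(p v, q w) ≤ R + R′`, so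
#   `γθ = e^{8μ(2R+R′)}·αc·hr·αr∕(1−lamA)`, `γθ′ = e^{8μ(2R+R′)}·αc·hc·αr∕(1−lamA)`, `αθ = βθ = e^{8μ(R+R′)}·hr·αr`
# — the weighted letters ARE the plain letters times a range factor: `γθ < 1` is SMALLNESS (`μ·range` and the Dobrushin constant), NOT a
# condition on `Γ`.  THE END restates (475) with the weights instantiated: the only geometry hypothesis left is the site letter
# `Σ_y e^{−μ·d(p x,p y)} ≤ S` (row NE7b, node U5c; (475), (456) `whitened_cross_rowsum_le`∕`whitened_cross_colsum_le`∕`whitened_obs_rowsum_le`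
# BY NAME; [folklore])

Cell `pub-balaban`, sub-cell `t4`, spine estimate NE7b (`T4WeightBudget.RelWeightBound`; the cell's OWN estimate — NOT PRINTED in
[Bałaban 1983–89], NOT PROVED).  Crux-route work under `Spine/NE7b/` by the row OWNER (`t4-ne7b-p1` gen 141, file (476)) under FREEZE
(0)'s crux-prover clause; NOTHING of Bałaban's is named as a Lean object, valued or asserted; no `T4Continuum/Support` leaf typed; no
`def`, no notation (the weights WRITTEN OUT); zero `sorry`.  Imports (BY NAME): the OWNER's (475) `…SupWhitenedThirdKernelLetter`
(`whitened_third_kernel_letter`; through it (456) `whitened_cross_rowsum_le`, `whitened_cross_colsum_le`, `whitened_obs_rowsum_le`,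
`whitened_obs_nonneg`, `whitened_cross_nonneg`).

WHAT IS PROVED ([folklore]; `X` a pseudometric space, `μ ≥ 0`):
* §1 the exponential weights: `expw_one_le`, `expw_diag`, `expw_triangle`, `expw_pow_eight`, `rho_pow_eight_le` (`ρ⁸ ≤ σσ`), `sigma_theta`
  (`σ_{xw} ≤ σ_{xz}θ_{zw}`).
* §2 finite range: `weight_le_of_support`, `cross_support` (`d(q x,q w) ≤ 2R + R′` on the support of `|A_{uw}||A_{vx}|Hk_{vu}`), `obs_support`
  (`d(p v,q w) ≤ R + R′` on the support of `|A_{uw}|Hk_{vu}`).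
* §3 the weighted letters: **`weighted_cross_rowsum_le`** (`γθ`), **`weighted_cross_colsum_le`** (`γθ′`), **`weighted_obs_rowsum_le`** (`αθ`),
  `weighted_obs_entry_le` (`βθ`).
* §4 THE END **`finite_range_third_kernel_letter`** — (475) for a finite-range factor, weights discharged; §5 toy.

HONEST (what this is NOT).  Triangle inequalities; the plain letters `αr, αc` (`ℓ¹` of `|A|`), `hr, hc` ((455)), `lamA`, the site letter
`S` and the smallness `γθ, γθ′ < 1` remain HYPOTHESES (the road's factor is not valued here); orders four and five ((d12)(3)) and the
kernel-letter class map ((d12)(4)) are NOT typed; scalar skeleton ((A3), NC-NE7b-α UNRULED); nothing of Bałaban's asserted.  BY-NAME EFFECT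
ON THE WALL: NONE.  NE7b NOT PRINTED ∕ NOT PROVED; spine PROVED 0∕9; rung (B)+1 — the programme's measures remain FINITE-torus statements;
NOT the mass gap, NOT Clay.  HONEST DEPENDENCY: continuum YM on T⁴ ⇐ BetaPertH ∧ nine spine estimates (0∕9 proved); BetaPertH ⇐ (D1) ∧
(D4) ∧ CAP+tail; G-an2-4 gates asym, D1 and NE2∕3∕4.
-/

set_option autoImplicit false
set_option maxSynthPendingDepth 3

noncomputable section

namespace Summit.QuantumFields.BalabanUV.T4Continuum.NE7b.SupFiniteRangeGeometryLetters

open MeasureTheory ProbabilityTheory Finset Real Matrix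
open scoped BigOperators Matrix
open SupWhitenedFirstOrderLetters (whitened_cross_rowsum_le whitened_cross_colsum_le whitened_obs_rowsum_le whitened_obs_nonneg
  whitened_cross_nonneg)
open SupWhitenedThirdKernelLetter (whitened_third_kernel_letter)

variable {ι κ X : Type} [Fintype ι] [DecidableEq ι] [Fintype κ] [DecidableEq κ] [PseudoMetricSpace X]

/-! ## §1. The exponential weights of a pseudometric -/

section Weights

omit [Fintype ι] [DecidableEq ι] [Fintype κ] [DecidableEq κ]

/-- `1 ≤ e^{c·d(a,b)}` for `c ≥ 0`. [folklore] -/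
theorem expw_one_le {c : ℝ} (hc : 0 ≤ c) (a b : X) : 1 ≤ Real.exp (c * dist a b) := Real.one_le_exp (mul_nonneg hc dist_nonneg)

/-- `e^{c·d(a,a)} = 1`. [folklore] -/
theorem expw_diag (c : ℝ) (a : X) : Real.exp (c * dist a a) = 1 := by rw [dist_self, mul_zero, Real.exp_zero]

/-- **Submultiplicativity**: `e^{c·d(a,b′)} ≤ e^{c·d(a,b)}·e^{c·d(b,b′)}` for `c ≥ 0` (triangle inequality). [folklore] -/
theorem expw_triangle {c : ℝ} (hc : 0 ≤ c) (a b b' : X) : Real.exp (c * dist a b') ≤ Real.exp (c * dist a b) * Real.exp (c * dist b b') := by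
  rw [← Real.exp_add, Real.exp_le_exp, ← mul_add]
  exact mul_le_mul_of_nonneg_left (dist_triangle a b b') hc

/-- `(e^{μ·d})⁸ = e^{8μ·d}`. [folklore] -/
theorem expw_pow_eight (μ d : ℝ) : Real.exp (μ * d) ^ 8 = Real.exp (8 * μ * d) := by
  rw [← Real.exp_nat_mul]
  push_cast
  ring_nf

/-- **`ρ⁸ ≤ σσ`**: `(e^{μ·d(p x,p y)})⁸ ≤ e^{8μ·d(p x,q w)}·e^{8μ·d(p y,q w)}` for `μ ≥ 0`. [folklore] -/
theorem rho_pow_eight_le {μ : ℝ} (hμ : 0 ≤ μ) (p : ι → X) (q : κ → X) (x y : ι) (w : κ) :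
    Real.exp (μ * dist (p x) (p y)) ^ 8 ≤ Real.exp (8 * μ * dist (p x) (q w)) * Real.exp (8 * μ * dist (p y) (q w)) := by
  rw [expw_pow_eight, dist_comm (p y) (q w)]
  exact expw_triangle (by linarith) (p x) (q w) (p y)

/-- **Compatibility of the cross weight with the sampler weight**: `σ_{xw} ≤ σ_{xz}·θ_{zw}`. [folklore] -/
theorem sigma_theta {μ : ℝ} (hμ : 0 ≤ μ) (p : ι → X) (q : κ → X) (x : ι) (z w : κ) :
    Real.exp (8 * μ * dist (p x) (q w)) ≤ Real.exp (8 * μ * dist (p x) (q z)) * Real.exp (8 * μ * dist (q z) (q w)) :=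
  expw_triangle (by linarith) (p x) (q z) (q w)

end Weights

/-! ## §2. Finite range: the supports -/

section Support

omit [Fintype ι] [DecidableEq ι] [Fintype κ] [DecidableEq κ]

variable {A : Matrix ι κ ℝ} {Hk : ι → ι → ℝ} {p : ι → X} {q : κ → X} {R R' : ℝ}

omit [PseudoMetricSpace X] in
/-- A weight on the support: `t·e^{c·d} ≤ t·e^{c·D}` when `t ≥ 0`, `c ≥ 0` and `t = 0 ∨ d ≤ D`. [folklore] -/
theorem weight_le_of_support {t d D c : ℝ} (ht : 0 ≤ t) (hc : 0 ≤ c) (h : t = 0 ∨ d ≤ D) : t * Real.exp (c * d) ≤ t * Real.exp (c * D) := by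
  rcases h with h | h
  · rw [h, zero_mul, zero_mul]
  · exact mul_le_mul_of_nonneg_left (Real.exp_le_exp.2 (mul_le_mul_of_nonneg_left h hc)) ht

/-- **The support of the whitened cross majorant's terms**: if `|A_{uw}|·|A_{vx}|·Hk_{vu} ≠ 0` then `d(q x, q w) ≤ 2R + R′`. [folklore] -/
theorem cross_support (hAR : ∀ u w, A u w = 0 ∨ dist (p u) (q w) ≤ R) (hHkR : ∀ v u, Hk v u = 0 ∨ dist (p v) (p u) ≤ R') (x w : κ) (u v : ι) :
    |A u w| * |A v x| * Hk v u = 0 ∨ dist (q x) (q w) ≤ 2 * R + R' := by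
  rcases hAR u w with h1 | h1
  · left; rw [h1, abs_zero, zero_mul, zero_mul]
  rcases hAR v x with h2 | h2
  · left; rw [h2, abs_zero, mul_zero, zero_mul]
  rcases hHkR v u with h3 | h3
  · left; rw [h3, mul_zero]
  right
  rw [dist_comm] at h2
  calc dist (q x) (q w) ≤ dist (q x) (p v) + dist (p v) (q w) := dist_triangle _ _ _
    _ ≤ dist (q x) (p v) + (dist (p v) (p u) + dist (p u) (q w)) := by gcongr; exact dist_triangle _ _ _
    _ ≤ R + (R' + R) := by gcongr
    _ = 2 * R + R' := by ring

/-- **The support of the observables' profile terms**: if `|A_{uw}|·Hk_{vu} ≠ 0` then `d(p v, q w) ≤ R + R′`. [folklore] -/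
theorem obs_support (hAR : ∀ u w, A u w = 0 ∨ dist (p u) (q w) ≤ R) (hHkR : ∀ v u, Hk v u = 0 ∨ dist (p v) (p u) ≤ R') (v u : ι) (w : κ) :
    |A u w| * Hk v u = 0 ∨ dist (p v) (q w) ≤ R + R' := by
  rcases hAR u w with h1 | h1
  · left; rw [h1, abs_zero, zero_mul]
  rcases hHkR v u with h3 | h3
  · left; rw [h3, mul_zero]
  right
  calc dist (p v) (q w) ≤ dist (p v) (p u) + dist (p u) (q w) := dist_triangle _ _ _
    _ ≤ R' + R := by gcongr
    _ = R + R' := by ring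

end Support

/-! ## §3. The weighted letters of a finite-range factor -/

section Letters

variable {A : Matrix ι κ ℝ} {Hk : ι → ι → ℝ} {p : ι → X} {q : κ → X} {μ R R' αr αc hr hc lamA : ℝ}

omit [DecidableEq ι] in
/-- **THE WEIGHTED ROW SMALLNESS `γθ`**: `Σ_w C_{xw}·e^{8μ·d(q x,q w)} ≤ e^{8μ(2R+R′)}·αc·hr·αr∕(1−lamA)`. [folklore] -/
theorem weighted_cross_rowsum_le [Nonempty ι] (hHk0 : ∀ v u, 0 ≤ Hk v u) (hαr : ∀ u, ∑ w, |A u w| ≤ αr) (hαc : ∀ w, ∑ u, |A u w| ≤ αc)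
    (hhr : ∀ v, ∑ u, Hk v u ≤ hr) (hμ : 0 ≤ μ) (hAR : ∀ u w, A u w = 0 ∨ dist (p u) (q w) ≤ R)
    (hHkR : ∀ v u, Hk v u = 0 ∨ dist (p v) (p u) ≤ R') (hlamA1 : lamA < 1) (x : κ) :
    ∑ w, (if w = x then 0 else ∑ u, ∑ v, |A u w| * |A v x| * Hk v u) / (1 - lamA) * Real.exp (8 * μ * dist (q x) (q w)) ≤
      Real.exp (8 * μ * (2 * R + R')) * (αc * hr * αr) / (1 - lamA) := by
  have hl : 0 < 1 - lamA := by linarith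
  have h8 : 0 ≤ 8 * μ := by linarith
  have hterm : ∀ w, (if w = x then 0 else ∑ u, ∑ v, |A u w| * |A v x| * Hk v u) / (1 - lamA) * Real.exp (8 * μ * dist (q x) (q w)) ≤
      (∑ u, ∑ v, |A u w| * |A v x| * Hk v u * Real.exp (8 * μ * (2 * R + R'))) / (1 - lamA) := fun w => by
    rw [div_mul_eq_mul_div]
    refine div_le_div_of_nonneg_right ?_ hl.le
    have hJ : (if w = x then 0 else ∑ u, ∑ v, |A u w| * |A v x| * Hk v u) ≤ ∑ u, ∑ v, |A u w| * |A v x| * Hk v u := by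
      split_ifs
      · exact whitened_cross_nonneg hHk0 A x w
      · exact le_rfl
    refine (mul_le_mul_of_nonneg_right hJ (Real.exp_pos _).le).trans ?_
    rw [Finset.sum_mul]
    refine Finset.sum_le_sum fun u _ => ?_
    rw [Finset.sum_mul]
    exact Finset.sum_le_sum fun v _ => weight_le_of_support (mul_nonneg (mul_nonneg (abs_nonneg _) (abs_nonneg _)) (hHk0 v u)) h8
      (cross_support hAR hHkR x w u v)
  refine (Finset.sum_le_sum fun w _ => hterm w).trans ?_
  rw [← Finset.sum_div]
  refine div_le_div_of_nonneg_right ?_ hl.le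
  have e : ∑ w, ∑ u, ∑ v, |A u w| * |A v x| * Hk v u * Real.exp (8 * μ * (2 * R + R')) = Real.exp (8 * μ * (2 * R + R')) * ∑ w, ∑ u, ∑ v, |A u w| *
      |A v x| * Hk v u := by
    rw [Finset.mul_sum]
    refine Finset.sum_congr rfl fun w _ => ?_
    rw [Finset.mul_sum]
    refine Finset.sum_congr rfl fun u _ => ?_
    rw [Finset.mul_sum]
    exact Finset.sum_congr rfl fun v _ => by ring
  rw [e]
  exact mul_le_mul_of_nonneg_left (whitened_cross_rowsum_le hHk0 hαr hαc hhr x) (Real.exp_pos _).le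

omit [DecidableEq ι] in
/-- **THE WEIGHTED COLUMN SMALLNESS `γθ′`**: `Σ_x C_{xw}·e^{8μ·d(q x,q w)} ≤ e^{8μ(2R+R′)}·αc·hc·αr∕(1−lamA)`. [folklore] -/
theorem weighted_cross_colsum_le [Nonempty ι] (hHk0 : ∀ v u, 0 ≤ Hk v u) (hαr : ∀ u, ∑ w, |A u w| ≤ αr) (hαc : ∀ w, ∑ u, |A u w| ≤ αc)
    (hhc : ∀ u, ∑ v, Hk v u ≤ hc) (hμ : 0 ≤ μ) (hAR : ∀ u w, A u w = 0 ∨ dist (p u) (q w) ≤ R)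
    (hHkR : ∀ v u, Hk v u = 0 ∨ dist (p v) (p u) ≤ R') (hlamA1 : lamA < 1) (w : κ) :
    ∑ x, (if w = x then 0 else ∑ u, ∑ v, |A u w| * |A v x| * Hk v u) / (1 - lamA) * Real.exp (8 * μ * dist (q x) (q w)) ≤
      Real.exp (8 * μ * (2 * R + R')) * (αc * hc * αr) / (1 - lamA) := by
  have hl : 0 < 1 - lamA := by linarith
  have h8 : 0 ≤ 8 * μ := by linarith
  have hterm : ∀ x, (if w = x then 0 else ∑ u, ∑ v, |A u w| * |A v x| * Hk v u) / (1 - lamA) * Real.exp (8 * μ * dist (q x) (q w)) ≤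
      (∑ u, ∑ v, |A u w| * |A v x| * Hk v u * Real.exp (8 * μ * (2 * R + R'))) / (1 - lamA) := fun x => by
    rw [div_mul_eq_mul_div]
    refine div_le_div_of_nonneg_right ?_ hl.le
    have hJ : (if w = x then 0 else ∑ u, ∑ v, |A u w| * |A v x| * Hk v u) ≤ ∑ u, ∑ v, |A u w| * |A v x| * Hk v u := by
      split_ifs
      · exact whitened_cross_nonneg hHk0 A x w
      · exact le_rfl
    refine (mul_le_mul_of_nonneg_right hJ (Real.exp_pos _).le).trans ?_
    rw [Finset.sum_mul]
    refine Finset.sum_le_sum fun u _ => ?_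
    rw [Finset.sum_mul]
    exact Finset.sum_le_sum fun v _ => weight_le_of_support (mul_nonneg (mul_nonneg (abs_nonneg _) (abs_nonneg _)) (hHk0 v u)) h8
      (cross_support hAR hHkR x w u v)
  refine (Finset.sum_le_sum fun x _ => hterm x).trans ?_
  rw [← Finset.sum_div]
  refine div_le_div_of_nonneg_right ?_ hl.le
  have e : ∑ x, ∑ u, ∑ v, |A u w| * |A v x| * Hk v u * Real.exp (8 * μ * (2 * R + R')) = Real.exp (8 * μ * (2 * R + R')) * ∑ x, ∑ u, ∑ v, |A u w| *
      |A v x| * Hk v u := by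
    rw [Finset.mul_sum]
    refine Finset.sum_congr rfl fun x _ => ?_
    rw [Finset.mul_sum]
    refine Finset.sum_congr rfl fun u _ => ?_
    rw [Finset.mul_sum]
    exact Finset.sum_congr rfl fun v _ => by ring
  rw [e]
  exact mul_le_mul_of_nonneg_left (whitened_cross_colsum_le hHk0 hαr hαc hhc w) (Real.exp_pos _).le

omit [DecidableEq ι] [DecidableEq κ] in
/-- **THE WEIGHTED PROFILE LETTER `αθ`**: `Σ_w a^v_w·e^{8μ·d(p v,q w)} ≤ e^{8μ(R+R′)}·hr·αr`. [folklore] -/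
theorem weighted_obs_rowsum_le (hHk0 : ∀ v u, 0 ≤ Hk v u) (hαr : ∀ u, ∑ w, |A u w| ≤ αr) (hhr : ∀ v, ∑ u, Hk v u ≤ hr) (hμ : 0 ≤ μ)
    (hAR : ∀ u w, A u w = 0 ∨ dist (p u) (q w) ≤ R) (hHkR : ∀ v u, Hk v u = 0 ∨ dist (p v) (p u) ≤ R') (v : ι) :
    ∑ w, (∑ u, |A u w| * Hk v u) * Real.exp (8 * μ * dist (p v) (q w)) ≤ Real.exp (8 * μ * (R + R')) * (hr * αr) := by
  have h8 : 0 ≤ 8 * μ := by linarith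
  have hterm : ∀ w, (∑ u, |A u w| * Hk v u) * Real.exp (8 * μ * dist (p v) (q w)) ≤ (∑ u, |A u w| * Hk v u) * Real.exp (8 * μ * (R + R')) := fun w =>
      by
    rw [Finset.sum_mul, Finset.sum_mul]
    exact Finset.sum_le_sum fun u _ => weight_le_of_support (mul_nonneg (abs_nonneg _) (hHk0 v u)) h8 (obs_support hAR hHkR v u w)
  refine (Finset.sum_le_sum fun w _ => hterm w).trans ?_
  rw [← Finset.sum_mul, mul_comm]
  exact mul_le_mul_of_nonneg_left (whitened_obs_rowsum_le hHk0 hαr hhr v) (Real.exp_pos _).le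

omit [DecidableEq ι] [DecidableEq κ] in
/-- **THE WEIGHTED ENTRY LETTER `βθ`** (one nonnegative term of the previous sum): `a^v_w·e^{8μ·d(p v,q w)} ≤ e^{8μ(R+R′)}·hr·αr`. [folklore] -/
theorem weighted_obs_entry_le (hHk0 : ∀ v u, 0 ≤ Hk v u) (hαr : ∀ u, ∑ w, |A u w| ≤ αr) (hhr : ∀ v, ∑ u, Hk v u ≤ hr) (hμ : 0 ≤ μ)
    (hAR : ∀ u w, A u w = 0 ∨ dist (p u) (q w) ≤ R) (hHkR : ∀ v u, Hk v u = 0 ∨ dist (p v) (p u) ≤ R') (v : ι) (w : κ) :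
    (∑ u, |A u w| * Hk v u) * Real.exp (8 * μ * dist (p v) (q w)) ≤ Real.exp (8 * μ * (R + R')) * (hr * αr) := by
  refine le_trans ?_ (weighted_obs_rowsum_le hHk0 hαr hhr hμ hAR hHkR v)
  exact Finset.single_le_sum (f := fun w => (∑ u, |A u w| * Hk v u) * Real.exp (8 * μ * dist (p v) (q w)))
    (fun w _ => mul_nonneg (whitened_obs_nonneg hHk0 A v w) (Real.exp_pos _).le) (Finset.mem_univ w)

end Letters

/-! ## §4. THE END: (475) for a finite-range factor, the weights discharged -/

section TheEnd

variable {U : EuclideanSpace ℝ ι → ℝ} {U' : EuclideanSpace ℝ ι → EuclideanSpace ℝ ι →L[ℝ] ℝ}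
  {U'' : EuclideanSpace ℝ ι → EuclideanSpace ℝ ι →L[ℝ] EuclideanSpace ℝ ι →L[ℝ] ℝ}
  {U₃ : EuclideanSpace ℝ ι → EuclideanSpace ℝ ι →L[ℝ] EuclideanSpace ℝ ι →L[ℝ] EuclideanSpace ℝ ι →L[ℝ] ℝ} {Hk : ι → ι → ℝ} {K3 : ι → ι → ι → ℝ}
  {A : Matrix ι κ ℝ} {p : ι → X} {q : κ → X}
  {γop κ₀ κ₁ κ₂ κ₃ κ₃r a τ δ θp lam lamA αr αc hr hc k3r k3c γ γ' μ R R' S : ℝ}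

/-- **THE END — THE THIRD-ORDER KERNEL LETTER FOR A FINITE-RANGE FACTOR.**  (475) `whitened_third_kernel_letter` with the weights
`θ_{zw} = e^{8μ·d(q z,q w)}`, `σ_{xw} = e^{8μ·d(p x,q w)}`, `ρ_{xy} = e^{μ·d(p x,p y)}` and the weighted letters of §3: for a factor of range
`R` and a Hessian majorant of range `R′`, under the plain letters, the two regulators, `λγ_op < 1`, the smallness `γ, γ′ < 1` AND the
weighted smallness `e^{8μ(2R+R′)}αc·hr·αr∕(1−lamA) < 1`, `e^{8μ(2R+R′)}αc·hc·αr∕(1−lamA) < 1`, and the site letter `Σ_y e^{−μ·d(p x,p y)} ≤ S`: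
`Σ_y Σ_z |T(ψ)[e_x,e_y,e_z]| ≤ κ₃r + (2αr·k3r·αc·hc + hr·αr·αc·k3c)(1−γ)⁻¹(1−γ′)⁻¹∕(1−lamA) + 4√(m₄K)·S²` with
`K = αθ(1−γθ)⁻¹·αθ(1−γθ′)⁻¹∕(1−lamA)`, `αθ = e^{8μ(R+R′)}hr·αr`. [folklore] -/
theorem finite_range_third_kernel_letter [Nonempty κ] (hΓop : (γop • (1 : Matrix ι ι ℝ) - A * Aᵀ).PosSemidef) (Y : Finset ι)
    (hUd : ∀ φ : EuclideanSpace ℝ ι, HasFDerivAt U (U' φ) φ) (hU'd : ∀ φ : EuclideanSpace ℝ ι, HasFDerivAt U' (U'' φ) φ)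
    (hU''d : ∀ φ : EuclideanSpace ℝ ι, HasFDerivAt U'' (U₃ φ) φ) (hU₃c : Continuous U₃) (hκ₀ : 0 ≤ κ₀) (hκ₁ : 0 ≤ κ₁) (ha : 0 ≤ a) (hκ₂ : 0 ≤ κ₂)
        (hκ₃ : 0 ≤ κ₃)
    (hτ : 0 < τ) (hδ : 0 < δ) (hθ0 : 0 < θp) (hθ1 : θp < 1) (hκθ : (2 * κ₀ * (1 + τ) + 4 * δ) * γop ≤ θp) (hκθw : 2 * κ₀ * (1 + τ) * γop + 4 * δ ≤ θp)
    (hstab : ∀ φ : EuclideanSpace ℝ ι, -(κ₀ * ∑ x ∈ Y, φ x ^ 2) ≤ U φ)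
    (hU'b : ∀ φ : EuclideanSpace ℝ ι, ‖U' φ‖ ≤ κ₁ * (a + ∑ x ∈ Y, φ x ^ 2)) (hU''b : ∀ φ : EuclideanSpace ℝ ι, ‖U'' φ‖ ≤ κ₂)
    (hU₃b : ∀ φ : EuclideanSpace ℝ ι, ‖U₃ φ‖ ≤ κ₃) (hlam : 0 ≤ lam)
    (hUsec : ∀ s : ℝ, 0 ≤ s → s ≤ 1 → ∀ a b : EuclideanSpace ℝ ι,
      U ((1 - s) • a + s • b) - lam / 2 * (s * (1 - s)) * ∑ i, (a i - b i) ^ 2 ≤ (1 - s) * U a + s * U b)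
    (hρg : lam * γop < 1)
    -- the majorants and their letters
    (hHk : ∀ (φ : EuclideanSpace ℝ ι) (x z : ι), |U'' φ (EuclideanSpace.single z (1 : ℝ)) (EuclideanSpace.single x (1 : ℝ))| ≤ Hk x z)
    (hHk0 : ∀ v u, 0 ≤ Hk v u)
    (hK3 : ∀ (φ : EuclideanSpace ℝ ι) (u x y : ι),
      |U₃ φ (EuclideanSpace.single u (1 : ℝ)) (EuclideanSpace.single x (1 : ℝ)) (EuclideanSpace.single y (1 : ℝ))| ≤ K3 x y u)
    (hK30 : ∀ x y u, 0 ≤ K3 x y u)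
    (hU₃row : ∀ (φ : EuclideanSpace ℝ ι) (x : ι), ∑ y, ∑ z, |U₃ φ (EuclideanSpace.single x (1 : ℝ)) (EuclideanSpace.single y (1 : ℝ))
        (EuclideanSpace.single z (1 : ℝ))| ≤ κ₃r)
    (hhr : ∀ v, ∑ u, Hk v u ≤ hr) (hhc : ∀ u, ∑ v, Hk v u ≤ hc) (hk3r : ∀ x, ∑ y, ∑ u, K3 x y u ≤ k3r) (hk3c : ∀ u, ∑ y, ∑ z, K3 y z u ≤ k3c)
    -- the factor's letters and the smallness
    (ψ : EuclideanSpace ℝ ι) (hαr : ∀ u, ∑ w, |A u w| ≤ αr) (hαc : ∀ w, ∑ u, |A u w| ≤ αc)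
    (hlamA : ∀ x : κ, ∑ u, ∑ v, |A u x| * |A v x| * Hk v u ≤ lamA) (hlamA1 : lamA < 1)
    (hγ : αc * hr * αr / (1 - lamA) ≤ γ) (hγ1 : γ < 1) (hγ' : αc * hc * αr / (1 - lamA) ≤ γ') (hγ'1 : γ' < 1)
    -- the geometry: placements, rate, ranges, the weighted smallness, the site letter
    (hμ : 0 ≤ μ) (hAR : ∀ u w, A u w = 0 ∨ dist (p u) (q w) ≤ R) (hHkR : ∀ v u, Hk v u = 0 ∨ dist (p v) (p u) ≤ R')
    (hγθ1 : Real.exp (8 * μ * (2 * R + R')) * (αc * hr * αr) / (1 - lamA) < 1) (hγθ'1 : Real.exp (8 * μ * (2 * R + R')) * (αc * hc * αr) / (1 - lamA)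
        < 1)
    (x : ι) (hS : ∑ y, 1 / Real.exp (μ * dist (p x) (p y)) ≤ S) :
    ∑ y, ∑ z, |(((∫ ω : EuclideanSpace ℝ ι, exp (-U (ω + ψ)) ∂(multivariateGaussian 0 (A * Aᵀ)))⁻¹ • (∫ ω : EuclideanSpace ℝ ι, (exp (-U (ω + ψ)) •
        (U₃ (ω + ψ) -
        (((ContinuousLinearMap.smulRightL ℝ (EuclideanSpace ℝ ι) (EuclideanSpace ℝ ι →L[ℝ] ℝ)) (U' (ω + ψ))).comp (U'' (ω + ψ)) +
            (((ContinuousLinearMap.smulRightL ℝ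
        (EuclideanSpace ℝ ι) (EuclideanSpace ℝ ι →L[ℝ] ℝ))).comp (U'' (ω + ψ))).flip (U' (ω + ψ)))) + (exp (-U (ω + ψ)) • -U' (ω + ψ)).smulRight (U''
            (ω + ψ) - (U' (ω +
        ψ)).smulRight (U' (ω + ψ)))) ∂(multivariateGaussian 0 (A * Aᵀ))) + ((-((∫ ω : EuclideanSpace ℝ ι, exp (-U (ω + ψ)) ∂(multivariateGaussian 0
            (A * Aᵀ))) ^ 2)⁻¹) • -(∫ ω :
        EuclideanSpace ℝ ι, exp (-U (ω + ψ)) • U' (ω + ψ) ∂(multivariateGaussian 0 (A * Aᵀ)))).smulRight (∫ ω : EuclideanSpace ℝ ι, exp (-U (ω + ψ))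
            • (U'' (ω + ψ) - (U' (ω +
        ψ)).smulRight (U' (ω + ψ))) ∂(multivariateGaussian 0 (A * Aᵀ)))) + (((ContinuousLinearMap.smulRightL ℝ (EuclideanSpace ℝ ι) (EuclideanSpace ℝ
            ι →L[ℝ] ℝ)) (((∫ ω :
        EuclideanSpace ℝ ι, exp (-U (ω + ψ)) ∂(multivariateGaussian 0 (A * Aᵀ))) ^ 2)⁻¹ • (∫ ω : EuclideanSpace ℝ ι, exp (-U (ω + ψ)) • U' (ω + ψ)
            ∂(multivariateGaussian 0
        (A * Aᵀ))))).comp (∫ ω : EuclideanSpace ℝ ι, exp (-U (ω + ψ)) • (U'' (ω + ψ) - (U' (ω + ψ)).smulRight (U' (ω + ψ))) ∂(multivariateGaussian 0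
            (A * Aᵀ))) +
        (((ContinuousLinearMap.smulRightL ℝ (EuclideanSpace ℝ ι) (EuclideanSpace ℝ ι →L[ℝ] ℝ))).comp (((∫ ω : EuclideanSpace ℝ ι, exp (-U (ω + ψ))
            ∂(multivariateGaussian 0
        (A * Aᵀ))) ^ 2)⁻¹ • (∫ ω : EuclideanSpace ℝ ι, exp (-U (ω + ψ)) • (U'' (ω + ψ) - (U' (ω + ψ)).smulRight (U' (ω + ψ))) ∂(multivariateGaussian
            0 (A * Aᵀ))) + ((-2 / (∫ ω :
        EuclideanSpace ℝ ι, exp (-U (ω + ψ)) ∂(multivariateGaussian 0 (A * Aᵀ))) ^ 3) • -(∫ ω : EuclideanSpace ℝ ι, exp (-U (ω + ψ)) • U' (ω + ψ)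
            ∂(multivariateGaussian 0
        (A * Aᵀ)))).smulRight (∫ ω : EuclideanSpace ℝ ι, exp (-U (ω + ψ)) • U' (ω + ψ) ∂(multivariateGaussian 0 (A * Aᵀ))))).flip (∫ ω :
            EuclideanSpace ℝ ι, exp (-U (ω + ψ)) • U' (ω
        + ψ) ∂(multivariateGaussian 0 (A * Aᵀ))))) (EuclideanSpace.single x (1 : ℝ)) (EuclideanSpace.single y (1 : ℝ)) (EuclideanSpace.single z (1 :
            ℝ))| ≤
      κ₃r + (2 * (αr * k3r * (αc * hc)) + hr * αr * (αc * k3c)) * (1 - γ)⁻¹ * (1 - γ')⁻¹ / (1 - lamA) +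
        4 * Real.sqrt (5 * (κ₂ ^ 4 * γop ^ 2) / (1 - lam * γop) ^ 2 * (Real.exp (8 * μ * (R + R')) * (hr * αr) * (1 - Real.exp (8 * μ * (2 * R + R'))
            * (αc * hr * αr) / (1 - lamA))⁻¹ *
          (Real.exp (8 * μ * (R + R')) * (hr * αr) * (1 - Real.exp (8 * μ * (2 * R + R')) * (αc * hc * αr) / (1 - lamA))⁻¹) / (1 - lamA))) * S ^ 2 :=
              by
  haveI : Nonempty ι := ⟨x⟩
  have hαr0 : 0 ≤ αr := (Finset.sum_nonneg fun w _ => abs_nonneg (A x w)).trans (hαr x)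
  have hhr0 : 0 ≤ hr := (Finset.sum_nonneg fun u _ => hHk0 x u).trans (hhr x)
  have hβ : 0 ≤ Real.exp (8 * μ * (R + R')) * (hr * αr) := mul_nonneg (Real.exp_pos _).le (mul_nonneg hhr0 hαr0)
  exact whitened_third_kernel_letter (θ := fun z w => Real.exp (8 * μ * dist (q z) (q w))) (σ := fun x w => Real.exp (8 * μ * dist (p x) (q w)))
    (ρ := fun x y => Real.exp (μ * dist (p x) (p y))) hΓop Y hUd hU'd hU''d hU₃c hκ₀ hκ₁ ha hκ₂ hκ₃ hτ hδ hθ0 hθ1 hκθ hκθw hstab hU'b hU''b hU₃b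
    hlam hUsec hρg hHk hHk0 hK3 hK30 hU₃row hhr hhc hk3r hk3c ψ hαr hαc hlamA hlamA1 hγ hγ1 hγ' hγ'1
    (fun z w => expw_one_le (by linarith) (q z) (q w)) (fun z => expw_diag _ (q z)) (fun z y w => expw_triangle (by linarith) (q z) (q y) (q w))
    (fun x w => (Real.exp_pos _).le) (fun x z w => sigma_theta hμ p q x z w)
    (fun x y => expw_one_le hμ (p x) (p y)) (fun x y => by rw [dist_comm]) (fun x y z => expw_triangle hμ (p x) (p y) (p z))
    (fun x y w => rho_pow_eight_le hμ p q x y w)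
    (fun z => weighted_cross_rowsum_le hHk0 hαr hαc hhr hμ hAR hHkR hlamA1 z) hγθ1
    (fun w => weighted_cross_colsum_le hHk0 hαr hαc hhc hμ hAR hHkR hlamA1 w) hγθ'1
    (fun v => weighted_obs_rowsum_le hHk0 hαr hhr hμ hAR hHkR v) hβ (fun v w => weighted_obs_entry_le hHk0 hαr hhr hμ hAR hHkR v w) x hS

end TheEnd

/-! ## §5. Toy -/

/-- Toy (§2): a term with a zero factor carries any weight. -/
example (d D : ℝ) : (0 : ℝ) * Real.exp (1 * d) ≤ 0 * Real.exp (1 * D) := weight_le_of_support le_rfl zero_le_one (Or.inl rfl)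

end Summit.QuantumFields.BalabanUV.T4Continuum.NE7b.SupFiniteRangeGeometryLetters

end
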